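import Literature.AlgebraicGeometry.HodgeTheory.AlgebraicityLocusIUnionClosedProofs
import Literature.AlgebraicGeometry.HodgeTheory.QuasiProjectiveOfAffine
import Summits.HodgeConjecture.HodgeConjecture.Theorems.AnchorTransportVariationalHodgeCurveThickness

/-!
# Route HeckePrymWeil — `WeilVariationalHodge` (stmt-HodgeConjecture-14497), line `Sketch`, skeleton v4:
# the algebraicity locus over a curve is everything or countable (`stub_curveDichotomy`)

Registered stub `stub_curveDichotomy` of skeleton v4 (lead c3). For a smooth projective family `f : 𝒳 ⟶ C`
of relative dimension `n` with quasi-projective total space over a smooth irreducible AFFINE CURVE `C`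
(`topologicalKrullDim C = 1`) and a global class `A ∈ H^{2q}(𝒳(ℂ); ℂ)`, the algebraicity locus
`{t ∈ C(ℂ) | A|_{𝒳_t} ∈ N^q H^{2q}(𝒳_t(ℂ); ℂ)}` is either ALL of `C(ℂ)` or COUNTABLE.

Proof. By the Hilbert-scheme theorem of the tree (`charlesSchnell_algebraicityLocus_iUnion_closed_holds`,
Charles–Schnell 2014, proof of Prop. 11.3.11; the affine curve is quasi-projective,
`IsQuasiProjectiveOver.of_isAffine`) the locus is `⋃ⱼ Wⱼ(ℂ)` for countably many Zariski-closed `Wⱼ ⊆ C`.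
If some `Wⱼ = C` the locus is everything; otherwise every `Wⱼ` is a proper closed subset of the irreducible
Noetherian curve, hence finite (`finite_of_isClosed_ne_univ_of_topologicalKrullDim_le_one`, stmt-1076 lead), with
finitely many complex points over it (`finite_setOf_pt_mem`), and the locus is a countable union of finite sets.

Consequence recorded for the line (`mem_algebraicClasses_of_not_countable_curve`): over a curve, UNCOUNTABLY many
algebraic fibres force algebraicity at every fibre — the form in which the core stub
`stub_anchorSpreadsUncountably` feeds the composition. (The sibling forms "a non-empty Euclidean-open set of
algebraic fibres forces all" and "all but finitely many forces all" are the tree's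
`map_fiberι_mem_algebraicClasses_of_isOpen` and `variationalHodge_curve_dominance`.)
-/

noncomputable section

-- every declaration of this problem lives in `Summit.HodgeConjecture.HodgeConjecture.…` (summit = sub-problem)
set_option linter.dupNamespace false

open CategoryTheory AlgebraicGeometry TopologicalSpace
open Literature.AlgebraicGeometry.Motives Literature.AlgebraicGeometry.HodgeTheory

namespace Summit.HodgeConjecture.HodgeConjecture.Theorems

/-- **Stub `stub_curveDichotomy` (skeleton v4 of line `Sketch`, crux stmt-HodgeConjecture-14497).** Over a smooth
irreducible affine curve `C`, the algebraicity locus of a global class `A ∈ H^{2q}(𝒳(ℂ); ℂ)` on a smooth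
projective family `f : 𝒳 ⟶ C` with quasi-projective total space is all of `C(ℂ)` or countable: it is a
countable union of complex-point sets of Zariski-closed `Wⱼ ⊆ C`
(`charlesSchnell_algebraicityLocus_iUnion_closed_holds`), and a proper closed subset of the curve carries only
finitely many complex points. [cite: CharlesSchnell2014Notes, Prop. 11.3.11 (proof)]
[cite: VoisinHodgeII2003, §7.3.2, proof of Thm. 7.19] -/
theorem stub_curveDichotomy (n q : ℕ) :
    ∀ ⦃𝒳 C : SchemeOver ℂ⦄ (f : 𝒳 ⟶ C), IsSmoothProjectiveFamily f n → IsQuasiProjectiveOver 𝒳 →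
      IrreducibleSpace C.left → IsAffine C.left → AlgebraicGeometry.Smooth C.hom →
      topologicalKrullDim C.left = 1 → ∀ (A : complexBetti 𝒳 (2 * q)),
      {t : ComplexPoints C | complexBetti.map (fiberι f t) (2 * q) A ∈ algebraicClasses (fiberOver f t) q} =
          Set.univ ∨
        Set.Countable {t : ComplexPoints C |
          complexBetti.map (fiberι f t) (2 * q) A ∈ algebraicClasses (fiberOver f t) q} := by
  intro 𝒳 C f hf h𝒳 hirr haff hsm hdim A
  haveI := hirr
  haveI := haff
  haveI := hsm
  haveI : IsLocallyNoetherian C.left := LocallyOfFiniteType.isLocallyNoetherian C.hom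
  haveI : CompactSpace C.left := isCompact_univ_iff.mp (isAffineOpen_top C.left).isCompact
  haveI : IsNoetherian C.left := {}
  have hC : IsQuasiProjectiveOver C := IsQuasiProjectiveOver.of_isAffine C
  obtain ⟨W, hWc, hW⟩ := charlesSchnell_algebraicityLocus_iUnion_closed_holds f n q h𝒳 hC hsm hf A
  by_cases huniv : ∃ j, W j = Set.univ
  · left
    obtain ⟨j, hj⟩ := huniv
    rw [hW]
    refine Set.eq_univ_of_forall fun t => Set.mem_iUnion.2 ⟨j, ?_⟩
    simp only [Set.mem_setOf_eq, hj, Set.mem_univ]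
  · right
    push Not at huniv
    rw [hW]
    exact Set.countable_iUnion fun j =>
      (finite_setOf_pt_mem
        (finite_of_isClosed_ne_univ_of_topologicalKrullDim_le_one hdim.le (hWc j) (huniv j))).countable

/-- **Over a curve, uncountably many algebraic fibres force algebraicity everywhere** (all `n`, `q`; smooth
projective family with quasi-projective total space over a smooth irreducible affine curve): the locus is not
countable, so by `stub_curveDichotomy` it is everything. This is how the core stub
`stub_anchorSpreadsUncountably` closes the rung over a sectioned curve. [cite: CharlesSchnell2014Notes, Prop. 11.3.11 (proof)] -/
theorem mem_algebraicClasses_of_not_countable_curve {n q : ℕ} {𝒳 C : SchemeOver ℂ} (f : 𝒳 ⟶ C)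
    (hf : IsSmoothProjectiveFamily f n) (h𝒳 : IsQuasiProjectiveOver 𝒳) [IrreducibleSpace C.left]
    [IsAffine C.left] [AlgebraicGeometry.Smooth C.hom] (hdim : topologicalKrullDim C.left = 1)
    (A : complexBetti 𝒳 (2 * q))
    (hA : ¬ Set.Countable {t : ComplexPoints C |
      complexBetti.map (fiberι f t) (2 * q) A ∈ algebraicClasses (fiberOver f t) q})
    (t : ComplexPoints C) :
    complexBetti.map (fiberι f t) (2 * q) A ∈ algebraicClasses (fiberOver f t) q := by
  rcases stub_curveDichotomy n q f hf h𝒳 ‹_› ‹_› ‹_› hdim A with huniv | hcount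
  · have ht : t ∈ {t : ComplexPoints C |
        complexBetti.map (fiberι f t) (2 * q) A ∈ algebraicClasses (fiberOver f t) q} := by
      rw [huniv]; exact Set.mem_univ t
    exact ht
  · exact absurd hcount hA

/-- **Conversely, algebraicity everywhere makes the locus uncountable** (the curve has uncountably many complex
points: `not_countable_complexPoints`, it is smooth of relative dimension `1`), so over a curve the rung is
EQUIVALENT to "the algebraicity locus is uncountable". [folklore] -/
theorem not_countable_of_forall_mem_algebraicClasses_curve {q : ℕ} {𝒳 C : SchemeOver ℂ} (f : 𝒳 ⟶ C)
    [IrreducibleSpace C.left] [IsAffine C.left] [AlgebraicGeometry.Smooth C.hom]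
    (hdim : topologicalKrullDim C.left = 1) [Nonempty (ComplexPoints C)] (A : complexBetti 𝒳 (2 * q))
    (hA : ∀ t : ComplexPoints C, complexBetti.map (fiberι f t) (2 * q) A ∈ algebraicClasses (fiberOver f t) q) :
    ¬ Set.Countable {t : ComplexPoints C |
      complexBetti.map (fiberι f t) (2 * q) A ∈ algebraicClasses (fiberOver f t) q} := by
  have huniv : {t : ComplexPoints C |
      complexBetti.map (fiberι f t) (2 * q) A ∈ algebraicClasses (fiberOver f t) q} = Set.univ :=
    Set.eq_univ_of_forall fun t => hA t
  rw [huniv]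
  obtain ⟨_, hm⟩ := isIntegral_and_smoothOfRelativeDimension_one C hdim
  haveI := hm
  exact not_countable_complexPoints C le_rfl

end Summit.HodgeConjecture.HodgeConjecture.Theorems

end
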